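import Literature.NumberTheory.EllipticCurves.ComplexTorus
import Literature.NumberTheory.EllipticCurves.ModularCurve
import Literature.NumberTheory.EllipticCurves.Greenberg1999.TwoTorsionMuInvariant
import HarnessLib

/-!
# Rational `2`-torsion points are half-periods (proofs)

For a Weierstrass model `W` and a period pair `L` with `g₂(L) = c₄(W)/12`, `g₃(L) = c₆(W)/216`
(`ModularForms.IsNeronLatticeOf W L`: `L` spans the period lattice `Λ` of the invariant differential,
and `z ↦ (℘_L(z) − b₂/12, (℘_L'(z) − a₁x − a₃)/2)` uniformises `W(ℂ)`), every point `(x, y)` of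
`W` of exact order `2` — i.e. with `2y + a₁x + a₃ = 0` — has `x = ℘_L(λ/2) − b₂/12` for a
HALF-PERIOD `λ/2`, `λ ∈ Λ ∖ 2Λ` (Silverman, AEC VI.3.6 with III.1: the `2`-torsion of `ℂ/Λ` is
`½Λ/Λ`, and `℘'` vanishes exactly at the half-periods).

Proof (no zero-counting): `x` is a root of the `2`-division cubic `4x³ + b₂x² + 2b₄x + b₆`
(`= (2y + a₁x + a₃)²` on the curve); by the tree's surjectivity of `℘` (`PeriodPair.exists_weierstrassP_eq`,
Liouville) pick `z ∉ Λ` with `℘(z) = x + b₂/12`; then `℘'(z)² = 4℘³ − g₂℘ − g₃ = 4x³ + b₂x² + 2b₄x + b₆ = 0`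
(Mathlib `PeriodPair.derivWeierstrassP_sq`, `c₄ = b₂² − 24b₄`, `c₆ = −b₂³ + 36b₂b₄ − 216b₆`), so
`(℘, ℘')(z) = (℘, ℘')(−z)` (`℘` even, `℘'` odd) and the tree's separation theorem
`PeriodPair.sub_mem_lattice_of_weierstrassP_eq` gives `λ := 2z ∈ Λ`.

* `exists_half_period_of_cubic_root` — the statement for a period pair with prescribed `g₂, g₃`;
* `exists_half_period_of_two_torsion` — for `W/ℂ` and a point with `2y + a₁x + a₃ = 0`;
* `exists_half_period_of_hasRationalTwoTorsionX` — for `W/ℚ`, `IsNeronLatticeOf (W.baseChange ℂ) L`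
  and `Greenberg1999.HasRationalTwoTorsionX W x` (the binders of route `EisensteinDepletionAtTwo`'s
  cruxes `StarGO2Sigma` / `StarOptBNSF`, where the half-period was so far an explicit hypothesis).

References: J. H. Silverman, *The Arithmetic of Elliptic Curves* (2nd ed., 2009), III.1, VI.3.6
[SilvermanAEC2009].
-/

noncomputable section

namespace Literature.NumberTheory.EllipticCurves

open ModularForms Greenberg1999

/-- **Roots of the `2`-division cubic are values of `℘` at half-periods.**  If `g₂(L) = (b₂² − 24b₄)/12`,
`g₃(L) = (−b₂³ + 36b₂b₄ − 216b₆)/216` and `4x³ + b₂x² + 2b₄x + b₆ = 0`, then `x = ℘_L(λ/2) − b₂/12`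
for some `λ ∈ Λ` with `λ/2 ∉ Λ`. [cite: SilvermanAEC2009, Prop. VI.3.6(b) and III.1] -/
theorem exists_half_period_of_cubic_root (L : PeriodPair) {b₂ b₄ b₆ : ℂ}
    (hg₂ : L.g₂ = (b₂ ^ 2 - 24 * b₄) / 12) (hg₃ : L.g₃ = (-b₂ ^ 3 + 36 * b₂ * b₄ - 216 * b₆) / 216)
    {x : ℂ} (hψ : 4 * x ^ 3 + b₂ * x ^ 2 + 2 * b₄ * x + b₆ = 0) :
    ∃ lam ∈ L.lattice, lam / 2 ∉ L.lattice ∧ L.weierstrassP (lam / 2) - b₂ / 12 = x := by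
  obtain ⟨z, hz, hzx⟩ := L.exists_weierstrassP_eq (x + b₂ / 12)
  -- `℘'(z) = 0`
  have hder : L.derivWeierstrassP z = 0 := by
    have hsq := L.derivWeierstrassP_sq z hz
    rw [hzx, hg₂, hg₃] at hsq
    have h0 : L.derivWeierstrassP z ^ 2 = 0 := by
      rw [hsq]
      linear_combination hψ
    exact pow_eq_zero_iff two_ne_zero |>.mp h0
  -- `(℘, ℘')(z) = (℘, ℘')(-z)`, so `2z ∈ Λ`
  have hnz : -z ∉ L.lattice := fun h ↦ hz (by simpa using neg_mem h)
  have h2z : z - -z ∈ L.lattice :=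
    L.sub_mem_lattice_of_weierstrassP_eq hz hnz (L.weierstrassP_neg z).symm
      (by rw [L.derivWeierstrassP_neg, hder, neg_zero])
  refine ⟨z - -z, h2z, ?_, ?_⟩
  · rwa [sub_neg_eq_add, ← two_mul, mul_div_cancel_left₀ _ two_ne_zero]
  · rw [sub_neg_eq_add, ← two_mul, mul_div_cancel_left₀ _ two_ne_zero, hzx]
    ring

/-- **A point of exact order `2` is a half-period.**  For `W/ℂ` with Néron-type period pair `L`
(`IsNeronLatticeOf W L`: `g₂ = c₄/12`, `g₃ = c₆/216`) and a point `(x, y)` on `W` with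
`2y + a₁x + a₃ = 0` (i.e. `P = −P`), `x = ℘_L(λ/2) − b₂/12` for some `λ ∈ Λ ∖ 2Λ`.
[cite: SilvermanAEC2009, Prop. VI.3.6(b) and III.1] -/
theorem exists_half_period_of_two_torsion (W : WeierstrassCurve ℂ) (L : PeriodPair)
    (hL : IsNeronLatticeOf W L) {x y : ℂ} (heq : W.toAffine.Equation x y)
    (h2 : 2 * y + W.a₁ * x + W.a₃ = 0) :
    ∃ lam ∈ L.lattice, lam / 2 ∉ L.lattice ∧ L.weierstrassP (lam / 2) - W.b₂ / 12 = x := by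
  have hψ : 4 * x ^ 3 + W.b₂ * x ^ 2 + 2 * W.b₄ * x + W.b₆ = 0 := by
    rw [WeierstrassCurve.Affine.equation_iff] at heq
    have e : (2 * y + W.a₁ * x + W.a₃) ^ 2 = 4 * x ^ 3 + W.b₂ * x ^ 2 + 2 * W.b₄ * x + W.b₆ := by
      simp only [WeierstrassCurve.b₂, WeierstrassCurve.b₄, WeierstrassCurve.b₆]
      linear_combination 4 * heq
    rw [← e, h2]
    ring
  refine exists_half_period_of_cubic_root L ?_ ?_ hψ
  · rw [hL.1, WeierstrassCurve.c₄]
  · rw [hL.2, WeierstrassCurve.c₆]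

/-- **A rational point of order `2` is a half-period of the Néron lattice.**  For `W/ℚ`, a period
pair `L` with `IsNeronLatticeOf (W.baseChange ℂ) L`, and `x : ℚ` with `HasRationalTwoTorsionX W x`
(a rational point `(x, y)` of `W` with `2y + a₁x + a₃ = 0`), there is `λ ∈ Λ` with `λ/2 ∉ Λ` and
`℘_L(λ/2) − b₂/12 = x`.  (Used by the cruxes `StarGO2Sigma` / `StarOptBNSF` of route
`EisensteinDepletionAtTwo`, where this half-period was an explicit binder.)
[cite: SilvermanAEC2009, Prop. VI.3.6(b) and III.1] -/
theorem exists_half_period_of_hasRationalTwoTorsionX (W : WeierstrassCurve ℚ) (L : PeriodPair)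
    (hL : IsNeronLatticeOf (W.baseChange ℂ) L) {x : ℚ} (hx : HasRationalTwoTorsionX W x) :
    ∃ lam ∈ L.lattice, lam / 2 ∉ L.lattice ∧
      L.weierstrassP (lam / 2) - ((W.b₂ : ℚ) : ℂ) / 12 = ((x : ℚ) : ℂ) := by
  obtain ⟨y, heq, h2⟩ := hx
  have hψ : 4 * x ^ 3 + W.b₂ * x ^ 2 + 2 * W.b₄ * x + W.b₆ = 0 := by
    rw [WeierstrassCurve.Affine.equation_iff] at heq
    have e : (2 * y + W.a₁ * x + W.a₃) ^ 2 = 4 * x ^ 3 + W.b₂ * x ^ 2 + 2 * W.b₄ * x + W.b₆ := by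
      simp only [WeierstrassCurve.b₂, WeierstrassCurve.b₄, WeierstrassCurve.b₆]
      linear_combination 4 * heq
    rw [← e, h2]
    ring
  have hψ' : 4 * (x : ℂ) ^ 3 + (W.b₂ : ℂ) * (x : ℂ) ^ 2 + 2 * (W.b₄ : ℂ) * (x : ℂ) + (W.b₆ : ℂ) = 0 := by
    have := congr_arg (fun t : ℚ ↦ (t : ℂ)) hψ
    simpa using this
  have hc₄ : (W.baseChange ℂ).c₄ = ((W.b₂ : ℂ) ^ 2 - 24 * (W.b₄ : ℂ)) := by
    rw [WeierstrassCurve.baseChange, WeierstrassCurve.map_c₄, WeierstrassCurve.c₄]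
    simp
  have hc₆ : (W.baseChange ℂ).c₆ = (-(W.b₂ : ℂ) ^ 3 + 36 * (W.b₂ : ℂ) * (W.b₄ : ℂ) - 216 * (W.b₆ : ℂ)) := by
    rw [WeierstrassCurve.baseChange, WeierstrassCurve.map_c₆, WeierstrassCurve.c₆]
    simp
  exact exists_half_period_of_cubic_root L (by rw [hL.1, hc₄]) (by rw [hL.2, hc₆]) hψ'

end Literature.NumberTheory.EllipticCurves

end
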